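import Summits.BirchSwinnertonDyer.Rank1Residual.X1.LocalPackageRat
import Summits.BirchSwinnertonDyer.Rank1Residual.X1.LocalStrictPackageOne
import HarnessLib

/-!
# THE `e = 1` LOCAL PACKAGE at the prime `wp` of `ℚ_n` above an ANOMALOUS good ordinary `p`, for
# curves WITHOUT a rational point of order `p` (route R1′, V99; raw form)
# (cell `b2b-bsdres`, unit `b2b-bsdres-eisenstein-p1`, gen 21; X1R0-GAPMAP §29–§30)

HONEST FRAMING (run/shared/lean/b2b/bsd-rank1-residual/, verbatim in every file): the goal of the
cell is to DELETE the COMBINATION-SHAPED residual classes of the Birch–Swinnerton-Dyer formula for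
ALL analytic-rank `≤ 1` elliptic curves over `ℚ` — "full BSD formula for every rank `≤ 1` curve in
class `C`" assembled STRICTLY from published theorems — so that the rank-`≤ 1` remainder becomes
exactly the CONSTRUCTION-SHAPED classes, which are TYPED (missing-input `Prop`s), NOT attempted.
This is not "finishing BSD". Sub-cell `b2b-bsdres-eisenstein-p1`: research route; NO CLAIM BEYOND
STATED CLASSES; nothing here changes a label; nothing is booked. THEOREMS ONLY — no definition, no
named fact introduced; Tate's local Euler–Poincaré characteristic (`hEP`, the tree's named fact
`localEulerPoincareCharacteristic`) is a HYPOTHESIS exactly as in gen 20's `X1/LocalPackageRat`.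

## What and why

Gen 20's `LocalPackageRat.exists_addSubgroup_redStrict` is the `K`-general local package at
`K = ℚ_n` (`A₀` = reductions of `E[p]`, `ψ = κ_n ∘ res`) with index `p²`, using a RATIONAL point of
order `p` twice: to make `p` anomalous (`hs_anom`) and for `#E(L_w)[p] ≥ p` (`ht`). THIS FILE is the
same assembly with the anomaly as the HYPOTHESIS `hanom : p ∣ #Ẽ(𝔽_p)` (on the leaf X1 ∩ {r = 0}:
`a_p ≡ 1 (mod p)`) and NO torsion hypothesis, ending in gen 21's
`LocalStrictPackageOne.exists_strict_addSubgroup_one` (index `p¹`):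

* **`exists_addSubgroup_redStrict_one`**: `∃ 𝓛 ⊇ 𝓚_wp`, `p ^ 1 · #𝓚_wp ≤ #𝓛`, classes' cocycles
  reduce to `Õ` on `I_{(ℚ_n)_wp} ∩ res⁻¹ Gal(ℚ̄/ℚ_{n,∞})`.

This is the local term `a ≥ 1` of X1R0-GAPMAP §14.1 at layer `n ≥ 1` for the `δ = 0` members
(memo `V76-LOCAL-TERM-PLAN.md` §4.10 (c)); consumer: census class `282310u@3` (member `282310u2`,
`E(ℚ_3)[3] = 0`, `t₁ + 1 = 8`). The proof is gen 20's, verbatim up to the two changed steps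
(engineering notes of X1R0-GAPMAP §29.4 apply: opaque `s₀`/`ψ`, no `obtain` on applications).

References: [GreenbergLNM1716] §2 Prop. 2.4, §3 Lemma 3.4 (p. 89), §5 pp. 114–118;
[MilneADT2006] I Thm. 2.8; [SilvermanAEC2009] VII.§2–3; [SerreGaloisCohomology1997] II.§1.1.
-/

noncomputable section

open scoped Classical NNReal

open Function Field NumberField IsDedekindDomain WeierstrassCurve
  Literature.NumberTheory.EllipticCurves Literature.NumberTheory.GaloisRepresentations
  IsDedekindDomain.HeightOneSpectrum
  Summit.BirchSwinnertonDyer.Rank1Residual.Additive.LocalTransport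
  Summit.BirchSwinnertonDyer.Rank1Residual.Additive
  Summit.BirchSwinnertonDyer.Rank1Residual.Additive.ZpTower
  Summit.BirchSwinnertonDyer.Rank1Residual.X2.GreenbergVatsalReductionDatum
open Literature.NumberTheory.EllipticCurves.GreenbergSelmer (inertiaIn inertiaInToH inertia
  mem_inertiaIn_iff)
open Literature.NumberTheory.GaloisRepresentations.DiscreteGaloisModule (mu MuCarrier)

set_option autoImplicit false

-- NB: no local `[NumberField (κ.layer n)]` hypotheses in this file — the tree's global instance
-- `ZpExtension.numberField_layer` is used throughout (X1R0-GAPMAP §29.4).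

namespace Summit.BirchSwinnertonDyer.Rank1Residual.X1.LocalPackageRatOne

variable (W : WeierstrassCurve ℚ) [W.IsElliptic] [W.IsGloballyMinimal] {p : ℕ} [hp : Fact p.Prime]
  (κ : ZpExtension ℚ p) (n : ℕ) (κn : ZpExtension (κ.layer n) p)
  (hκn : ∀ σ : Field.absoluteGaloisGroup (κ.layer n),
    (κn σ).toAdd * (p : ℤ_[p]) ^ n = (κ (resGal (K := ℚ) (κ.layer n) σ)).toAdd)
  {v : HeightOneSpectrum (𝓞 ℚ)} (hpv : ((p : ℕ) : 𝓞 ℚ) ∈ v.asIdeal)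
  (hΔ : ¬ (p : ℤ) ∣ minimalDiscriminantInt W)
  (wp : HeightOneSpectrum (𝓞 (κ.layer n))) [wp.asIdeal.LiesOver v.asIdeal]
  -- the factorisation data (n1011 shape)
  (ι₂ : AlgebraicClosure (v.adicCompletion ℚ) ≃+* AlgebraicClosure (wp.adicCompletion (κ.layer n)))
  (hι₂ : ∀ x : v.adicCompletion ℚ,
    ι₂ (algebraMap (v.adicCompletion ℚ) (AlgebraicClosure (v.adicCompletion ℚ)) x) =
      algebraMap (wp.adicCompletion (κ.layer n)) (AlgebraicClosure (wp.adicCompletion (κ.layer n)))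
        (adicCompletionMap (K := ℚ) (κ.layer n) v wp x))
  (ι' : AlgebraicClosure (κ.layer n) →ₐ[κ.layer n] AlgebraicClosure (wp.adicCompletion (κ.layer n)))
  (hcompat : ∀ z : AlgebraicClosure ℚ,
    ι' (closureEmb (K := ℚ) (κ.layer n) z) = ι₂ (closureEmb (K := ℚ) (v.adicCompletion ℚ) z))
  (hfix : ∀ h : absoluteGaloisGroup (v.adicCompletion ℚ),
    resGalOfEmb (closureEmb (K := ℚ) (v.adicCompletion ℚ)) h ∈ κ.layerSubgroup n →
    ∀ y : wp.adicCompletion (κ.layer n),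
      (show AlgebraicClosure (v.adicCompletion ℚ) ≃ₐ[v.adicCompletion ℚ]
          AlgebraicClosure (v.adicCompletion ℚ) from h)
        (ι₂.symm (algebraMap _ (AlgebraicClosure (wp.adicCompletion (κ.layer n))) y)) =
        ι₂.symm (algebraMap _ (AlgebraicClosure (wp.adicCompletion (κ.layer n))) y))
  (τ : Field.absoluteGaloisGroup (κ.layer n))
  (hτ : ι' = (closureEmb (K := κ.layer n) (wp.adicCompletion (κ.layer n))).comp
    ((show AlgebraicClosure (κ.layer n) ≃ₐ[κ.layer n] AlgebraicClosure (κ.layer n) from τ) :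
      AlgebraicClosure (κ.layer n) →ₐ[κ.layer n] AlgebraicClosure (κ.layer n)))

/-! ## §1. The good reduction of the minimal model over the valuation ring of `|·|_wp` -/

/-! ## The `e = 1` package at `wp` in raw form -/

set_option maxHeartbeats 800000 in -- many `ℚ`-level vs `K`-general instance unifications
-- (`Algebra ℚ ℚ_n` via `DivisionRing.toRatAlgebra` vs the layer's `IntermediateField.algebra`, equal
-- only after unfolding) — each costs ~10⁴–10⁵ heartbeats; as in gen 20's `X1/LocalPackageRat`.
include hκn hpv hΔ hι₂ hcompat hfix hτ in
/-- **THE `e = 1` LOCAL PACKAGE at `wp`, raw form** (for a given reduction datum `(w, M, red)` at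
`wp`; `p` odd, `p ∤ Δ_E`, `p ∤ a_p`, `p ∣ #Ẽ(𝔽_p)` — ANOMALOUS, no rational `p`-torsion assumed):
there is `𝓛 ≤ H¹((ℚ_n)_wp, E[p])` with `𝓚_wp ≤ 𝓛`, `p ^ 1 · #𝓚_wp ≤ #𝓛`, all of whose classes have
cocycles `ψ` with `red(pointsMap ψ(g)) = Õ` for every `g ∈ I_{(ℚ_n)_wp}` restricting into
`Gal(ℚ̄/ℚ_{n,∞})` — gen 21's `K`-general `X1/LocalStrictPackageOne.exists_strict_addSubgroup_one` at
`K = ℚ_n` with `A₀ =` the reductions of `E[p]`, `ψ = κ_n ∘ res` (`hI`, `hμ`, `hs_anom` from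
`X1/LocalPackageTransportGalois`). [cite: GreenbergLNM1716, §2 Prop. 2.4, §3 Lemma 3.4 (p. 89), §5 pp. 114–118]
[cite: MilneADT2006, I Thm. 2.8] [cite: SilvermanAEC2009, VII.§2–3] -/
theorem exists_addSubgroup_redStrict_one
    {w : Valuation (AlgebraicClosure (wp.adicCompletion (κ.layer n))) ℝ≥0}
    (hw : ∀ x, (w x : ℝ) = spectralNorm (wp.adicCompletion (κ.layer n))
      (AlgebraicClosure (wp.adicCompletion (κ.layer n))) x)
    {M : WeierstrassCurve ↥w.valuationSubring}
    (hMK : M.baseChange (AlgebraicClosure (wp.adicCompletion (κ.layer n))) =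
      (W.baseChange (κ.layer n)).baseChange (AlgebraicClosure (wp.adicCompletion (κ.layer n))))
    {red : localPoints (W.baseChange (κ.layer n)) (wp.adicCompletion (κ.layer n)) →+
      (M.map (IsLocalRing.residue ↥w.valuationSubring)).toAffine.Point}
    (hred : ∀ P, red P = M.reducePoint (Affine.Point.congrEquiv hMK.symm P)) (hΔ' : IsUnit M.Δ)
    (hκ : κ.IsCyclotomic) (hodd : p ≠ 2)
    (hord : ¬ (p : ℤ) ∣ W.frobeniusTrace p) (hanom : p ∣ W.reductionPointCount p)
    (hEP : localEulerPoincareCharacteristic (wp.adicCompletion (κ.layer n))) :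
    ∃ 𝓛 : AddSubgroup (galoisCohomology (GaloisRep.restrictField (wp.adicCompletion (κ.layer n))
        ((W.baseChange (κ.layer n)).torsionGaloisModule (p : ℤ))) 1),
      (W.baseChange (κ.layer n)).kummerLocalConditionAt (p : ℤ) (wp.adicCompletion (κ.layer n)) ≤ 𝓛 ∧
      p ^ 1 * Nat.card ((W.baseChange (κ.layer n)).kummerLocalConditionAt (p : ℤ)
        (wp.adicCompletion (κ.layer n))) ≤ Nat.card 𝓛 ∧
      ∀ c ∈ 𝓛, ∀ ψc : contOneCocycles (GaloisRep.restrictField (wp.adicCompletion (κ.layer n))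
          ((W.baseChange (κ.layer n)).torsionGaloisModule (p : ℤ))).toTopRep,
        oneCocycleClass _ ψc = c →
        ∀ g : absoluteGaloisGroup (wp.adicCompletion (κ.layer n)),
          g ∈ absInertia (wp.adicCompletion (κ.layer n)) →
          absGaloisRestrict (κ.layer n) (wp.adicCompletion (κ.layer n)) g ∈ κn.kerSubgroup →
          red (pointsMap (W.baseChange (κ.layer n)) (wp.adicCompletion (κ.layer n))
            ((ψc.1 g : geomTorsion (W.baseChange (κ.layer n)) (p : ℤ)) :
              WeierstrassCurve.geomPoints (W.baseChange (κ.layer n)))) = 0 := by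
  have hp0 : (p : ℤ) ≠ 0 := by exact_mod_cast hp.out.ne_zero
  haveI : NeZero p := ⟨hp.out.ne_zero⟩
  haveI : Finite (geomTorsion (W.baseChange (κ.layer n)) (p : ℤ)) :=
    finite_geomTorsion_of_neZero (W.baseChange (κ.layer n)) p
  -- (2) the prime is anomalous: HYPOTHESIS `hanom` (no rational `p`-torsion needed)
  -- (3) `s₀ = red ∘ pointsMap` on `E[p]`, its image `A₀` has order `p`
  -- (`s₀` as an OPAQUE local — a `let` body is unfolded by `isDefEq` and times out — and
  -- introduced by `Exists.elim`: `obtain` on a non-variable goes through `generalize`, which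
  -- times out at `whnf` on this goal.)
  refine (?_ : ∃ s₀ : geomTorsion (W.baseChange (κ.layer n)) (p : ℤ) →+
      (M.map (IsLocalRing.residue ↥w.valuationSubring)).toAffine.Point,
      ∀ Q, s₀ Q = red (pointsMap (W.baseChange (κ.layer n)) (wp.adicCompletion (κ.layer n))
        (Q : WeierstrassCurve.geomPoints (W.baseChange (κ.layer n))))).elim fun s₀ hs₀ ↦ ?_
  · exact ⟨red.comp ((pointsMap (W.baseChange (κ.layer n)) (wp.adicCompletion (κ.layer n))).comp
      (geomTorsion (W.baseChange (κ.layer n)) (p : ℤ)).subtype), fun _ ↦ rfl⟩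
  have hwv := specVal_spec v
  have hΔu := W.isUnit_Δ_localIntModel hpv hwv hΔ
  haveI hcharw : CharP (IsLocalRing.ResidueField ((specVal v).valuationSubring)) p :=
    GoodModelLine.charP_residueField_specVal p hpv
  have hordA := W.exists_zsmul_eq_zero_localRed_ne_zero hwv hΔu (localRed W p hpv hΔ)
    (localRed_apply W p hpv hΔ) hpv hΔ hord
  obtain ⟨hker, -, -⟩ := W.localRed_ordinary_filtration hΔu (localRed W p hpv hΔ)
    (localRed_apply W p hpv hΔ) hordA
  -- (NB: `obtain … := <application>` goes through `generalize` and times out at `whnf` in this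
  -- context; existentials are NAMED by `have` first throughout this proof.)
  have hk : ∃ P₁ : localPoints W (v.adicCompletion ℚ), localRed W p hpv hΔ P₁ = 0 ∧ addOrderOf P₁ = p :=
    (hker 1).imp fun _ h ↦ ⟨h.1, h.2.1.trans (pow_one p)⟩
  obtain ⟨P₁, hP₁0, hP₁ord⟩ := hk
  obtain ⟨P₂, hP₂p, hP₂⟩ := hordA
  have hP₁p : (p : ℤ) • P₁ = 0 := by
    rw [← hP₁ord, natCast_zsmul]
    exact addOrderOf_nsmul_eq_zero P₁
  have hP₁ne : P₁ ≠ 0 := by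
    intro h
    rw [h, addOrderOf_zero] at hP₁ord
    exact hp.out.one_lt.ne hP₁ord
  have hQ₁ex := LocalPackageRat.exists_geomTorsion_red_iff W κ n hpv hΔ wp ι₂ hι₂ ι' hcompat τ hτ hw
    hMK hred hΔ' P₁ hP₁p
  have hQ₂ex := LocalPackageRat.exists_geomTorsion_red_iff W κ n hpv hΔ wp ι₂ hι₂ ι' hcompat τ hτ hw
    hMK hred hΔ' P₂ hP₂p
  obtain ⟨Q₁, hQ₁ne, hQ₁red⟩ := hQ₁ex
  obtain ⟨Q₂, -, hQ₂red⟩ := hQ₂ex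
  have hA₀ : Nat.card s₀.range = p :=
    LocalPackageParts.natCard_range_eq_of_card_eq_sq s₀ hp.out
      (by rw [natCard_geomTorsion _ (p : ℤ) hp0, Int.natAbs_natCast])
      ⟨Q₁, hQ₁ne hP₁ne, (hs₀ Q₁).trans (hQ₁red.mpr hP₁0)⟩
      ⟨Q₂, fun h ↦ hP₂ (hQ₂red.mp ((hs₀ Q₂).symm.trans h))⟩
  -- (4) the `K`-general package at `K = ℚ_n`
  -- (`ψ = κ_n ∘ res` as an opaque local, like `s₀`)
  refine (⟨κn.toContinuousMonoidHom.comp (absGaloisRestrict (κ.layer n) (wp.adicCompletion (κ.layer n))),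
    fun _ ↦ rfl⟩ : ∃ ψ : absoluteGaloisGroup (wp.adicCompletion (κ.layer n)) →ₜ* Multiplicative ℤ_[p],
      ∀ g, ψ g = κn (absGaloisRestrict (κ.layer n) (wp.adicCompletion (κ.layer n)) g)).elim
    fun ψ hψ ↦ ?_
  have hI : ∃ g ∈ absInertia (wp.adicCompletion (κ.layer n)), ¬ (p : ℤ_[p]) ∣ (ψ g).toAdd := by
    have h := LocalPackageTransportGalois.exists_absInertia_not_dvd κ n κn hκn hpv wp ι₂ hι₂ ι'
      hcompat hfix τ hτ hκ
    obtain ⟨g, hgI, hg⟩ := h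
    exact ⟨g, hgI, fun hdvd ↦ hg (by rw [← hψ g]; exact hdvd)⟩
  have hψH : ∀ g, absGaloisRestrict (κ.layer n) (wp.adicCompletion (κ.layer n)) g ∈ κn.kerSubgroup →
      ψ g = 1 := fun g hg ↦ by
    rw [hψ g]; exact ZpExtension.mem_kerSubgroup.mp hg
  haveI : Finite s₀.range := Finite.of_surjective s₀.rangeRestrict s₀.rangeRestrict_surjective
  have hs_red : ∀ Q, s₀.rangeRestrict Q = 0 ↔
      red (pointsMap (W.baseChange (κ.layer n)) (wp.adicCompletion (κ.layer n))
        (Q : WeierstrassCurve.geomPoints (W.baseChange (κ.layer n)))) = 0 := fun Q ↦ by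
    constructor
    · intro h
      have h' : ((s₀.rangeRestrict Q : s₀.range) :
          (M.map (IsLocalRing.residue ↥w.valuationSubring)).toAffine.Point) =
          ((0 : s₀.range) : (M.map (IsLocalRing.residue ↥w.valuationSubring)).toAffine.Point) :=
        congrArg Subtype.val h
      have h'' : s₀ Q = 0 := h'
      rw [hs₀ Q] at h''
      exact h''
    · intro h
      apply Subtype.ext
      have h'' : s₀ Q = 0 := by rw [hs₀ Q]; exact h
      exact h''
  have h𝓛ex := LocalStrictPackageOne.exists_strict_addSubgroup_one (W.baseChange (κ.layer n))
    p wp hw hMK hred κn.kerSubgroup (↥s₀.range) hA₀ s₀.rangeRestrict hs_red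
    (fun g Q ↦ Subtype.ext (by
      change s₀ _ = s₀ Q
      rw [hs₀, hs₀]
      exact LocalPackageTransportGalois.red_pointsMap_smul_eq W κ n hpv hΔ wp hw hMK hred ι₂ hι₂ ι'
        hcompat τ hτ hord hanom hΔ' g Q))
    ψ hI hψH hEP
    (LocalPackageTransportGalois.forall_mu_eq_zero κ n hpv wp ι₂ hfix hκ hodd)
  exact h𝓛ex

end Summit.BirchSwinnertonDyer.Rank1Residual.X1.LocalPackageRatOne

end
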